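import Literature.AnabelianGeometry.SemiGraphs.Corollary27iOfCoveringSupply

/-!
# [SemiAnbd] Cor. 2.7 (i) modulo (D3) AT THE CONSTRUCTED COVERING `𝒢_A → 𝒢` — proof

Mochizuki, *Semi-graphs of anabelioids*, Publ. RIMS **42** (2006) 221–322, Cor. 2.7 (i) p. 30
[cite: MochizukiSemiAnbd2006, Cor. 2.7(i) p.30].  abc-iut cell, layer L3, row «C27i-cov» (abc-iut-w4-d071),
second half: the CLOSER RE-CUT.  `Corollary27iOfDoubleCosets.lean` (abc-iut-w4-d071) proves Cor. 2.7 (i)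
modulo the dictionary item (D3) `covering_subgraphComponents_doubleCosets` for EVERY finite étale covering
`φ`; abc-iut-L3-d3 (STATUS 2026-08-26T01:58:15Z) records that the group clauses (P3)/(P4) of (D3) are
construction-side facts of print's covering `𝒢_A → 𝒢` with no known route for an abstract `φ`, so the
L3 programme (abc-iut-w5-d041 (P1)(P2) `covering_subgraphComponents_count_one`, abc-iut-L6-t17 D3b core,
abc-iut-L3-d3 RS-cov) proves (D3) AT `φ := A.coveringHomCan : A.coveringGraph → 𝒢` (abc-iut-L3-t5's
construction with canonical 2-cells, `CoveringHomCanonical.lean`).  This PROOF-ONLY file (no `def`) states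
that target as the single hypothesis `hD3cov` — (D3)'s binders VERBATIM with `𝒢′ := A.coveringGraph`,
`φ := A.coveringHomCan`, for GALOIS `A` (print, p. 30: "a connected finite Galois étale covering";
the reduction only ever applies (D3) to the covering attached to a Galois object) (so that abc-iut-w5-d041's assembly `…_of_groupClauses` applies pointwise, unchanged)
— and derives from it, through the supplied-covering engine `corollary_2_7_i_of_coveringSupply`
(`Corollary27iOfCoveringSupply.lean`) fed with the four kernel theorems about `coveringHomCan`
(`BObj.coveringHomCan_isFiniteEtaleCoveringOf` abc-iut-L3-t5, `…_isGlobalCoveringOf` abc-iut-L3-t5,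
`…_isBranchAligned` abc-iut-L4-t17, `…_isVertexAligned` abc-iut-w4-d071):

* `isCommensurablyTerminal_piHToPi_of_subgraphComponents_doubleCosets_coveringHomCan` (the engine),
* `corollary_2_7_i_of_subgraphComponents_doubleCosets_coveringHomCan` (the named fact `corollary_2_7_i`),
* `remark_2_7_2_of_subgraphComponents_doubleCosets_coveringHomCan` (abc-iut-L3-d1's formal consequence),
* `corollary_2_7_ii_of_prop25i_subgraphComponents_doubleCosets_coveringHomCan` (with `proposition_2_5_i`),
* and the sanity direction `subgraphComponents_doubleCosets_coveringHomCan_of_subgraphComponents_doubleCosets`: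
  the abstract (D3) implies `hD3cov` (the re-cut WEAKENS the hypothesis).

So the residual hypothesis between the tree and [SemiAnbd] Cor. 2.7 (i) / Rmk. 2.7.2 is exactly «(D3) at
`coveringHomCan`» (and Prop. 2.5 (i) for Cor. 2.7 (ii)).  Honest framing: conditional on `hD3cov`; typed ≠
proved for it; nothing here bears on [IUTchIII] Cor. 3.12.
-/

namespace Literature.AnabelianGeometry.SemiGraphs

open CategoryTheory CategoryTheory.PreGaloisCategory
open Literature.AnabelianGeometry.Anabelioids
open scoped Pointwise

namespace SemiGraphOfAnabelioids

universe v₁ u₁ u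

/-- **The abstract (D3) implies (D3) at the constructed covering** (instantiate `𝒢′ := A.coveringGraph`,
`φ := A.coveringHomCan`): the re-cut hypothesis `hD3cov` of this file is WEAKER than the dictionary item
`covering_subgraphComponents_doubleCosets`. [cite: MochizukiSemiAnbd2006, Cor. 2.7(i) p.30] -/
theorem subgraphComponents_doubleCosets_coveringHomCan_of_subgraphComponents_doubleCosets
    (hD3 : covering_subgraphComponents_doubleCosets.{v₁, u₁, u}) :
    ∀ (𝒢 : SemiGraphOfAnabelioids.{v₁, u₁, u}) (A : 𝒢.BObj) (hc : 𝒢.IsConnected),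
      @IsGalois 𝒢.BObj _ (𝒢.galoisCategory_bObj hc) A →
      A.coveringGraph.IsConnected → A.coveringHomCan.IsFiniteEtaleCoveringOf A →
      A.coveringHomCan.IsGlobalCoveringOf A → A.coveringHomCan.IsVertexAligned →
      ∀ (v' : A.coveringGraph.graph.Vertex) (F' : A.coveringGraph.V v' ⥤ FintypeCat.{v₁})
        [FiberFunctor F'] (F : 𝒢.V (A.coveringHomCan.base.vertexMap v') ⥤ FintypeCat.{v₁})
        [FiberFunctor F] (e : (A.coveringHomCan.φV v').pullback ⋙ F' ≅ F)
        (H : 𝒢.graph.Subgraph), H.toSemiGraph.IsConnected → H.toSemiGraph.IsGraph →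
        ∀ (hv : A.coveringHomCan.base.vertexMap v' ∈ H.verts),
        let v := A.coveringHomCan.base.vertexMap v'
        let ι : A.coveringGraph.Pi v' F' →* 𝒢.Pi v F :=
          (Aut.autMulEquivOfIso (Functor.isoWhiskerLeft (𝒢.ρ v) e)).toMonoidHom.comp
            (pi1Map A.coveringHomCan.pullbackFunctor (A.coveringGraph.ρ v' ⋙ F'))
        let PH : Subgroup (𝒢.Pi v F) := (𝒢.piHToPi H ⟨v, hv⟩ F).range
        ∀ x₀ : (𝒢.ρ v ⋙ F).obj A, ι.range = MulAction.stabilizer (𝒢.Pi v F) x₀ →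
          ∃ d : {K : A.coveringGraph.graph.Subgraph // A.coveringHomCan.IsPreimageComponent H K} →
              𝒢.Pi v F,
            Function.Bijective (fun K => DoubleCoset.mk PH ι.range (d K)) ∧
            (∃ K₀ : {K : A.coveringGraph.graph.Subgraph // A.coveringHomCan.IsPreimageComponent H K},
              v' ∈ K₀.1.verts) ∧
            (∀ (K : {K : A.coveringGraph.graph.Subgraph // A.coveringHomCan.IsPreimageComponent H K})
              (hK : v' ∈ K.1.verts),
              d K ∈ ι.range ∧
                (ι.comp (A.coveringGraph.piHToPi K.1 ⟨v', hK⟩ F')).range = ι.range ⊓ PH) ∧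
            ∀ (K : {K : A.coveringGraph.graph.Subgraph // A.coveringHomCan.IsPreimageComponent H K})
              (w'' : K.1.toSemiGraph.Vertex) (F'' : A.coveringGraph.V w''.1 ⥤ FintypeCat.{v₁})
              [FiberFunctor F''] (α : A.coveringGraph.ρ w''.1 ⋙ F'' ≅ A.coveringGraph.ρ v' ⋙ F'),
              ∃ g : 𝒢.Pi v F,
                (ι.comp ((Aut.autMulEquivOfIso α).toMonoidHom.comp
                  (A.coveringGraph.piHToPi K.1 w'' F''))).range =
                    ι.range ⊓ ConjAct.toConjAct g⁻¹ • PH :=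
  fun 𝒢 A hc _ => hD3 𝒢 A.coveringGraph A.coveringHomCan A hc

/-- **The sub-semi-graph engine of [SemiAnbd] Cor. 2.7 (i), modulo (D3) at the constructed covering
`A.coveringHomCan : 𝒢_A → 𝒢` alone**: for `𝒢` connected, quasi-coherent and a graph of anabelioids, `ℍ` a
connected sub-graph with all vertices elevated, and any vertex `v ∈ ℍ` with basepoint `F`, the image of
`Π_ℍ → Π_𝒢` (read at `(v, F)`) is commensurably terminal — the supplied-covering engine at the covering
`(A.coveringGraph, A.coveringHomCan)`, which is attached to `A` locally, globally, with aligned branches and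
vertex groups by the kernel theorems of abc-iut-L3-t5 / abc-iut-L4-t17 / abc-iut-w4-d071.
[cite: MochizukiSemiAnbd2006, Cor. 2.7(i) p.30] -/
theorem isCommensurablyTerminal_piHToPi_of_subgraphComponents_doubleCosets_coveringHomCan
    (hD3cov : ∀ (𝒢 : SemiGraphOfAnabelioids.{v₁, u₁, u}) (A : 𝒢.BObj) (hc : 𝒢.IsConnected),
      @IsGalois 𝒢.BObj _ (𝒢.galoisCategory_bObj hc) A →
      A.coveringGraph.IsConnected → A.coveringHomCan.IsFiniteEtaleCoveringOf A →
      A.coveringHomCan.IsGlobalCoveringOf A → A.coveringHomCan.IsVertexAligned →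
      ∀ (v' : A.coveringGraph.graph.Vertex) (F' : A.coveringGraph.V v' ⥤ FintypeCat.{v₁})
        [FiberFunctor F'] (F : 𝒢.V (A.coveringHomCan.base.vertexMap v') ⥤ FintypeCat.{v₁})
        [FiberFunctor F] (e : (A.coveringHomCan.φV v').pullback ⋙ F' ≅ F)
        (H : 𝒢.graph.Subgraph), H.toSemiGraph.IsConnected → H.toSemiGraph.IsGraph →
        ∀ (hv : A.coveringHomCan.base.vertexMap v' ∈ H.verts),
        let v := A.coveringHomCan.base.vertexMap v'
        let ι : A.coveringGraph.Pi v' F' →* 𝒢.Pi v F :=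
          (Aut.autMulEquivOfIso (Functor.isoWhiskerLeft (𝒢.ρ v) e)).toMonoidHom.comp
            (pi1Map A.coveringHomCan.pullbackFunctor (A.coveringGraph.ρ v' ⋙ F'))
        let PH : Subgroup (𝒢.Pi v F) := (𝒢.piHToPi H ⟨v, hv⟩ F).range
        ∀ x₀ : (𝒢.ρ v ⋙ F).obj A, ι.range = MulAction.stabilizer (𝒢.Pi v F) x₀ →
          ∃ d : {K : A.coveringGraph.graph.Subgraph // A.coveringHomCan.IsPreimageComponent H K} →
              𝒢.Pi v F,
            Function.Bijective (fun K => DoubleCoset.mk PH ι.range (d K)) ∧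
            (∃ K₀ : {K : A.coveringGraph.graph.Subgraph // A.coveringHomCan.IsPreimageComponent H K},
              v' ∈ K₀.1.verts) ∧
            (∀ (K : {K : A.coveringGraph.graph.Subgraph // A.coveringHomCan.IsPreimageComponent H K})
              (hK : v' ∈ K.1.verts),
              d K ∈ ι.range ∧
                (ι.comp (A.coveringGraph.piHToPi K.1 ⟨v', hK⟩ F')).range = ι.range ⊓ PH) ∧
            ∀ (K : {K : A.coveringGraph.graph.Subgraph // A.coveringHomCan.IsPreimageComponent H K})
              (w'' : K.1.toSemiGraph.Vertex) (F'' : A.coveringGraph.V w''.1 ⥤ FintypeCat.{v₁})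
              [FiberFunctor F''] (α : A.coveringGraph.ρ w''.1 ⋙ F'' ≅ A.coveringGraph.ρ v' ⋙ F'),
              ∃ g : 𝒢.Pi v F,
                (ι.comp ((Aut.autMulEquivOfIso α).toMonoidHom.comp
                  (A.coveringGraph.piHToPi K.1 w'' F''))).range =
                    ι.range ⊓ ConjAct.toConjAct g⁻¹ • PH)
    (𝒢 : SemiGraphOfAnabelioids.{v₁, u₁, u}) (hc : 𝒢.IsConnected) (hg : 𝒢.IsGraphOfAnabelioids)
    (hq : 𝒢.IsQuasiCoherent) (H : 𝒢.graph.Subgraph) (hH : H.toSemiGraph.IsConnected)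
    (hHg : H.toSemiGraph.IsGraph) (hel : ∀ w : H.toSemiGraph.Vertex, 𝒢.IsElevated w.1)
    (v : 𝒢.graph.Vertex) (hvH : v ∈ H.verts) (F : 𝒢.V v ⥤ FintypeCat.{v₁}) [FiberFunctor F] :
    AbsoluteAnabelian.IsCommensurablyTerminal (𝒢.piHToPi H ⟨v, hvH⟩ F).range :=
  isCommensurablyTerminal_piHToPi_of_coveringSupply
    (fun 𝒢 A hc _ hA => ⟨A.coveringGraph, A.coveringHomCan, A.coveringHomCan_isFiniteEtaleCoveringOf,
      A.coveringHomCan_isGlobalCoveringOf, A.coveringHomCan_isBranchAligned, fun hc' =>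
        hD3cov 𝒢 A hc hA hc' A.coveringHomCan_isFiniteEtaleCoveringOf A.coveringHomCan_isGlobalCoveringOf
          A.coveringHomCan_isVertexAligned⟩)
    𝒢 hc hg hq H hH hHg hel v hvH F

/-- **[SemiAnbd] Cor. 2.7 (i), modulo (D3) at the constructed covering `𝒢_A → 𝒢` alone**: commensurable
terminality of `Π_ℍ` (connected sub-semi-graphs with elevated vertices) and of `Π_v` (elevated vertices) in
`Π_𝒢`, for `𝒢` connected, quasi-coherent and a graph — the named fact `corollary_2_7_i`
(`Commensurability.lean`, abc-iut-L3-t1) from `hD3cov` through `corollary_2_7_i_of_coveringSupply`.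
[cite: MochizukiSemiAnbd2006, Cor. 2.7(i) p.30] -/
theorem corollary_2_7_i_of_subgraphComponents_doubleCosets_coveringHomCan
    (hD3cov : ∀ (𝒢 : SemiGraphOfAnabelioids.{v₁, u₁, u}) (A : 𝒢.BObj) (hc : 𝒢.IsConnected),
      @IsGalois 𝒢.BObj _ (𝒢.galoisCategory_bObj hc) A →
      A.coveringGraph.IsConnected → A.coveringHomCan.IsFiniteEtaleCoveringOf A →
      A.coveringHomCan.IsGlobalCoveringOf A → A.coveringHomCan.IsVertexAligned →
      ∀ (v' : A.coveringGraph.graph.Vertex) (F' : A.coveringGraph.V v' ⥤ FintypeCat.{v₁})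
        [FiberFunctor F'] (F : 𝒢.V (A.coveringHomCan.base.vertexMap v') ⥤ FintypeCat.{v₁})
        [FiberFunctor F] (e : (A.coveringHomCan.φV v').pullback ⋙ F' ≅ F)
        (H : 𝒢.graph.Subgraph), H.toSemiGraph.IsConnected → H.toSemiGraph.IsGraph →
        ∀ (hv : A.coveringHomCan.base.vertexMap v' ∈ H.verts),
        let v := A.coveringHomCan.base.vertexMap v'
        let ι : A.coveringGraph.Pi v' F' →* 𝒢.Pi v F :=
          (Aut.autMulEquivOfIso (Functor.isoWhiskerLeft (𝒢.ρ v) e)).toMonoidHom.comp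
            (pi1Map A.coveringHomCan.pullbackFunctor (A.coveringGraph.ρ v' ⋙ F'))
        let PH : Subgroup (𝒢.Pi v F) := (𝒢.piHToPi H ⟨v, hv⟩ F).range
        ∀ x₀ : (𝒢.ρ v ⋙ F).obj A, ι.range = MulAction.stabilizer (𝒢.Pi v F) x₀ →
          ∃ d : {K : A.coveringGraph.graph.Subgraph // A.coveringHomCan.IsPreimageComponent H K} →
              𝒢.Pi v F,
            Function.Bijective (fun K => DoubleCoset.mk PH ι.range (d K)) ∧
            (∃ K₀ : {K : A.coveringGraph.graph.Subgraph // A.coveringHomCan.IsPreimageComponent H K},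
              v' ∈ K₀.1.verts) ∧
            (∀ (K : {K : A.coveringGraph.graph.Subgraph // A.coveringHomCan.IsPreimageComponent H K})
              (hK : v' ∈ K.1.verts),
              d K ∈ ι.range ∧
                (ι.comp (A.coveringGraph.piHToPi K.1 ⟨v', hK⟩ F')).range = ι.range ⊓ PH) ∧
            ∀ (K : {K : A.coveringGraph.graph.Subgraph // A.coveringHomCan.IsPreimageComponent H K})
              (w'' : K.1.toSemiGraph.Vertex) (F'' : A.coveringGraph.V w''.1 ⥤ FintypeCat.{v₁})
              [FiberFunctor F''] (α : A.coveringGraph.ρ w''.1 ⋙ F'' ≅ A.coveringGraph.ρ v' ⋙ F'),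
              ∃ g : 𝒢.Pi v F,
                (ι.comp ((Aut.autMulEquivOfIso α).toMonoidHom.comp
                  (A.coveringGraph.piHToPi K.1 w'' F''))).range =
                    ι.range ⊓ ConjAct.toConjAct g⁻¹ • PH) :
    corollary_2_7_i.{v₁, u₁, u} :=
  corollary_2_7_i_of_coveringSupply fun 𝒢 A hc _ hA =>
    ⟨A.coveringGraph, A.coveringHomCan, A.coveringHomCan_isFiniteEtaleCoveringOf,
      A.coveringHomCan_isGlobalCoveringOf, A.coveringHomCan_isBranchAligned, fun hc' =>
        hD3cov 𝒢 A hc hA hc' A.coveringHomCan_isFiniteEtaleCoveringOf A.coveringHomCan_isGlobalCoveringOf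
          A.coveringHomCan_isVertexAligned⟩

/-- **[SemiAnbd] Rmk. 2.7.2, modulo (D3) at the constructed covering alone**: commensurable terminality of
the subgroups `J` with `Π_v ≥ J` open in an elevated verticial subgroup (abc-iut-L3-d1's formal reduction
`remark_2_7_2_of_corollary_2_7_i`). [cite: MochizukiSemiAnbd2006, Rem. 2.7.2 p.30] -/
theorem remark_2_7_2_of_subgraphComponents_doubleCosets_coveringHomCan
    (hD3cov : ∀ (𝒢 : SemiGraphOfAnabelioids.{v₁, u₁, u}) (A : 𝒢.BObj) (hc : 𝒢.IsConnected),
      @IsGalois 𝒢.BObj _ (𝒢.galoisCategory_bObj hc) A →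
      A.coveringGraph.IsConnected → A.coveringHomCan.IsFiniteEtaleCoveringOf A →
      A.coveringHomCan.IsGlobalCoveringOf A → A.coveringHomCan.IsVertexAligned →
      ∀ (v' : A.coveringGraph.graph.Vertex) (F' : A.coveringGraph.V v' ⥤ FintypeCat.{v₁})
        [FiberFunctor F'] (F : 𝒢.V (A.coveringHomCan.base.vertexMap v') ⥤ FintypeCat.{v₁})
        [FiberFunctor F] (e : (A.coveringHomCan.φV v').pullback ⋙ F' ≅ F)
        (H : 𝒢.graph.Subgraph), H.toSemiGraph.IsConnected → H.toSemiGraph.IsGraph →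
        ∀ (hv : A.coveringHomCan.base.vertexMap v' ∈ H.verts),
        let v := A.coveringHomCan.base.vertexMap v'
        let ι : A.coveringGraph.Pi v' F' →* 𝒢.Pi v F :=
          (Aut.autMulEquivOfIso (Functor.isoWhiskerLeft (𝒢.ρ v) e)).toMonoidHom.comp
            (pi1Map A.coveringHomCan.pullbackFunctor (A.coveringGraph.ρ v' ⋙ F'))
        let PH : Subgroup (𝒢.Pi v F) := (𝒢.piHToPi H ⟨v, hv⟩ F).range
        ∀ x₀ : (𝒢.ρ v ⋙ F).obj A, ι.range = MulAction.stabilizer (𝒢.Pi v F) x₀ →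
          ∃ d : {K : A.coveringGraph.graph.Subgraph // A.coveringHomCan.IsPreimageComponent H K} →
              𝒢.Pi v F,
            Function.Bijective (fun K => DoubleCoset.mk PH ι.range (d K)) ∧
            (∃ K₀ : {K : A.coveringGraph.graph.Subgraph // A.coveringHomCan.IsPreimageComponent H K},
              v' ∈ K₀.1.verts) ∧
            (∀ (K : {K : A.coveringGraph.graph.Subgraph // A.coveringHomCan.IsPreimageComponent H K})
              (hK : v' ∈ K.1.verts),
              d K ∈ ι.range ∧
                (ι.comp (A.coveringGraph.piHToPi K.1 ⟨v', hK⟩ F')).range = ι.range ⊓ PH) ∧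
            ∀ (K : {K : A.coveringGraph.graph.Subgraph // A.coveringHomCan.IsPreimageComponent H K})
              (w'' : K.1.toSemiGraph.Vertex) (F'' : A.coveringGraph.V w''.1 ⥤ FintypeCat.{v₁})
              [FiberFunctor F''] (α : A.coveringGraph.ρ w''.1 ⋙ F'' ≅ A.coveringGraph.ρ v' ⋙ F'),
              ∃ g : 𝒢.Pi v F,
                (ι.comp ((Aut.autMulEquivOfIso α).toMonoidHom.comp
                  (A.coveringGraph.piHToPi K.1 w'' F''))).range =
                    ι.range ⊓ ConjAct.toConjAct g⁻¹ • PH) :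
    remark_2_7_2.{v₁, u₁, u} :=
  remark_2_7_2_of_corollary_2_7_i
    (corollary_2_7_i_of_subgraphComponents_doubleCosets_coveringHomCan hD3cov)

/-- **[SemiAnbd] Cor. 2.7 (ii), modulo (D3) at the constructed covering and Prop. 2.5 (i)**: relative
slimness consequences (abc-iut-L3-d1's reduction `corollary_2_7_ii_of_corollary_2_7_i`, whose other input is
the named fact `proposition_2_5_i`). [cite: MochizukiSemiAnbd2006, Cor. 2.7(ii) p.30] -/
theorem corollary_2_7_ii_of_prop25i_subgraphComponents_doubleCosets_coveringHomCan
    (h25 : proposition_2_5_i.{v₁, u₁, u})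
    (hD3cov : ∀ (𝒢 : SemiGraphOfAnabelioids.{v₁, u₁, u}) (A : 𝒢.BObj) (hc : 𝒢.IsConnected),
      @IsGalois 𝒢.BObj _ (𝒢.galoisCategory_bObj hc) A →
      A.coveringGraph.IsConnected → A.coveringHomCan.IsFiniteEtaleCoveringOf A →
      A.coveringHomCan.IsGlobalCoveringOf A → A.coveringHomCan.IsVertexAligned →
      ∀ (v' : A.coveringGraph.graph.Vertex) (F' : A.coveringGraph.V v' ⥤ FintypeCat.{v₁})
        [FiberFunctor F'] (F : 𝒢.V (A.coveringHomCan.base.vertexMap v') ⥤ FintypeCat.{v₁})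
        [FiberFunctor F] (e : (A.coveringHomCan.φV v').pullback ⋙ F' ≅ F)
        (H : 𝒢.graph.Subgraph), H.toSemiGraph.IsConnected → H.toSemiGraph.IsGraph →
        ∀ (hv : A.coveringHomCan.base.vertexMap v' ∈ H.verts),
        let v := A.coveringHomCan.base.vertexMap v'
        let ι : A.coveringGraph.Pi v' F' →* 𝒢.Pi v F :=
          (Aut.autMulEquivOfIso (Functor.isoWhiskerLeft (𝒢.ρ v) e)).toMonoidHom.comp
            (pi1Map A.coveringHomCan.pullbackFunctor (A.coveringGraph.ρ v' ⋙ F'))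
        let PH : Subgroup (𝒢.Pi v F) := (𝒢.piHToPi H ⟨v, hv⟩ F).range
        ∀ x₀ : (𝒢.ρ v ⋙ F).obj A, ι.range = MulAction.stabilizer (𝒢.Pi v F) x₀ →
          ∃ d : {K : A.coveringGraph.graph.Subgraph // A.coveringHomCan.IsPreimageComponent H K} →
              𝒢.Pi v F,
            Function.Bijective (fun K => DoubleCoset.mk PH ι.range (d K)) ∧
            (∃ K₀ : {K : A.coveringGraph.graph.Subgraph // A.coveringHomCan.IsPreimageComponent H K},
              v' ∈ K₀.1.verts) ∧
            (∀ (K : {K : A.coveringGraph.graph.Subgraph // A.coveringHomCan.IsPreimageComponent H K})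
              (hK : v' ∈ K.1.verts),
              d K ∈ ι.range ∧
                (ι.comp (A.coveringGraph.piHToPi K.1 ⟨v', hK⟩ F')).range = ι.range ⊓ PH) ∧
            ∀ (K : {K : A.coveringGraph.graph.Subgraph // A.coveringHomCan.IsPreimageComponent H K})
              (w'' : K.1.toSemiGraph.Vertex) (F'' : A.coveringGraph.V w''.1 ⥤ FintypeCat.{v₁})
              [FiberFunctor F''] (α : A.coveringGraph.ρ w''.1 ⋙ F'' ≅ A.coveringGraph.ρ v' ⋙ F'),
              ∃ g : 𝒢.Pi v F,
                (ι.comp ((Aut.autMulEquivOfIso α).toMonoidHom.comp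
                  (A.coveringGraph.piHToPi K.1 w'' F''))).range =
                    ι.range ⊓ ConjAct.toConjAct g⁻¹ • PH) :
    corollary_2_7_ii.{v₁, u₁, u} :=
  corollary_2_7_ii_of_corollary_2_7_i h25
    (corollary_2_7_i_of_subgraphComponents_doubleCosets_coveringHomCan hD3cov)

end SemiGraphOfAnabelioids

end Literature.AnabelianGeometry.SemiGraphs
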